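import Mathlib
import HarnessLib
import HarnessLib.Audit
import Summits.MatrixMultiplication.Statement
import Literature.Computability.AlgebraicComplexity.FlatteningBound
import HarnessLib.Audit.Status.Attr

/-!
Route: CommutativeSchemes

DORMANT since 2026-08-24T14:49:07Z (reconciler: no traction for 6.8 d (last activity item-evidence-added at 2026-08-17T18:12:28Z); parked, not closed — `ledger route dormant route-MatrixMultiplication-CommutativeSchemes --off` to reacti) — unstaffed, not closed; items shared with open routes are served there. `ledger route dormant <id> --off` reactivates.

# Route CommutativeSchemes — CU13 Conjecture 21 with the metric no-go — commutative association
schemes realising ⟨n,n,n⟩ at rank n^(2+o(1)) must have thin, group-like tops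

It suffices to show X = COMMUTATIVE REALISATION (Cohn–Umans 2013 Conjecture 21 in ε-form): for every
ε > 0 there are
n ≥ 2 and a commutative association scheme with r ≤ n^(2+ε) classes (a class map cls : X × X → [r]
whose diagonal is one
class, closed under transposition, with intersection numbers p^c_ab = #{z : cls(x,z)=a, cls(z,y)=b}
depending only on
c = cls(x,y) and symmetric in a,b) that REALISES ⟨n,n,n⟩ (CU13 Def. 11/12): injections α, β, γ :
[n]² → classes such
that α(a,b'), β(b,c'), γ(c,a') form a triangle (∃ x y z with (x,y) ∈ α(a,b'), (y,z) ∈ β(b,c'), (z,x)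
∈ γ(c,a')) iff
a=a', b=b', c=c'. X is the weakest of the combinatorial conjectures implying ω = 2 (CKSU05 Conj.
3.4/4.7 ⟹ X via CU13
Thm. 17/19; route GroupTheoreticSTPP's CThesis ⟹ X = support STPPTransfer). The route realises card
thick-top-schemes-no-go as the NEGATIVE half of the line: its thick-top lemma (support
ThickTopLemma, HammingNoGo) kills
Hamming schemes H(D,q), q ≥ 3, outright and every thick-top metric scheme, and the planner's own
search shows the
qualitative no-go is the wrong statement for thin (antipodal/bipartite) tops — H(8,2) and the 16-gon
realise ⟨2,2,2⟩ at
rank 9 = n³+1 — so the metric side is filed QUANTITATIVELY (crux MetricNoGain: rank ≥ c·n³ for every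
distance-regular
host); the residual positive class is translation schemes of unbounded exponent (crux
CyclicRealization).
Lean: `∀ ε : ℝ, 0 < ε → ∃ n : ℕ, 2 ≤ n ∧ ∃ (X : Type) (_ : Fintype X) (r : ℕ) (cls : X → X → Fin r),
(r : ℝ) ≤ (n : ℝ) ^ (2 + ε) ∧ (∀ x y z : X, cls x y = cls z z ↔ x = y) ∧ (∃ τ : Fin r → Fin r, ∀ x y
: X, cls y x = τ (cls x y)) ∧ (∃ p : Fin r → Fin r → Fin r → ℕ, (∀ (a b : Fin r) (x y : X),
(Finset.univ.filter (fun z : X => cls x z = a ∧ cls z y = b)).card = p a b (cls x y)) ∧ ∀ a b c :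
Fin r, p a b c = p b a c) ∧ ∃ α β γ : Fin n × Fin n → Fin r, Function.Injective α ∧
Function.Injective β ∧ Function.Injective γ ∧ ∀ a a' b b' c c' : Fin n, ((∃ x y z : X, cls x y = α
(a, b') ∧ cls y z = β (b, c') ∧ cls z x = γ (c, a')) ↔ (a = a' ∧ b = b' ∧ c = c'))`

## Assembly
Bookkeeping over the cone, PROVED sorry-free in the folder Sketch.lean (assembly_provable, axioms
propext/Classical.choice/Quot.sound):
given δ > 0 put ε = 2δ/3; CommutativeRealization gives n ≥ 2 and a scheme with r ≤ n^(2+ε) classes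
realising ⟨n,n,n⟩;
RealizationSRank gives a tensor t with the support of ⟨n,n,n⟩ and tensorRank t ≤ r ≤ n^(2+ε);
WeightRemoval gives
ω(ℂ) ≤ 2 + (3/2)ε = 2 + δ; so ω(ℂ) ≤ 2 (le_of_forall_pos_le_add) and omega_two_le closes ω(ℂ) = 2 =
MatrixMultiplication
(Iff.rfl). MetricNoGain and CyclicRealization are the negative side and the first positive milestone
of the target, not
hypotheses of the assembly.

Rationale: WHY THIS LINE. Mechanism (CohnUmans2013 = arXiv:1207.6528, §3–5): a realisation of ⟨n,n,n⟩ in the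
adjacency algebra of a commutative
scheme of rank r restricts the structural tensor of ℂ^r — the unit tensor ⟨r⟩, the most reversible
tensor there is —
onto a WEIGHTED matrix-multiplication tensor, so R_s(⟨n,n,n⟩) ≤ r (Prop. 9), n^(ω_s) ≤ r (Prop. 5)
and ω ≤ (3ω_s−2)/2
(Thm. 6): rank n^(2+o(1)) gives ω = 2 with no character-degree penalty, and
BlasiakChurchCohnGrochowNaslundSawinUmans2017
(p. 4) list association schemes as the one host class their slice-rank barrier does not touch; no
route held this line.
Imported: algebraic combinatorics of association schemes / distance-regular graphs (Delsarte1973,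
BrouwerHaemers2012 Ch. 12,
Brouwer–Cohen–Neumaier doi:10.1007/978-3-642-74341-2, survey arXiv:1410.6294) for the negative side
— the card's
order-theoretic observation that in a graded scheme the triangle relation at the top class is an
up-set in h(b)+h(c), and an
up-set contains no 2×2 permutation pattern — and S-rings over cyclic groups (cyclotomy, sum-product
BourgainGlibichukKonyagin2006, Pratt2024's Val(Z_n) programme) for the residual positive class. What
is new relative to
GroupTheoreticSTPP / GelfandPairHosts / the card: the target is the scheme-level conjecture itself
(weaker than every
group-theoretic thesis, linked by STPPTransfer), the assembly is typed and proved modulo two CU13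
facts filed as items
(RealizationSRank, WeightRemoval), and the metric no-go is made quantitative after the planner's
exhaustive search found
⟨2,2,2⟩ inside H(8,2) and C_16 (rank 9) — the card's qualitative claim fails exactly on thin tops.

RANKED CRUXES. #0 CommutativeRealization (target) — CU13 Conjecture 21, ε-form: for every ε > 0 some
commutative association scheme with at most n^(2+ε) classes realises ⟨n,n,n⟩, n ≥ 2 (card
thick-top-schemes-no-go, Assembly sketch; CohnUmans2013 Conj. 21). (why it might fail: Every known
commutative realisation is a Sym-power of bounded-exponent abelian STPP (CU13 Thm 20, ω_s ≤ 2.376)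
whose ε→0 limit is slice-rank-barred (BCCGNSU17 Thm B); metric hosts are dead (MetricNoGain) and
nothing is known to produce thin non-group tops at rank n^(2+ε).) [CohnUmans2013, arXiv:1207.6528,
CohnKleinbergSzegedyUmans2005, BlasiakChurchCohnGrochowNaslundSawinUmans2017]
#2 WeightRemoval (crux) — CU13 Prop. 5 + Thm. 6 in finite form (the unvendored named fact the
assembly needs, ranked first by plancard policy): if some tensor with the support of ⟨n,n,n⟩ (n ≥ 2)
has rank ≤ n^(2+ε), then ω(ℂ) ≤ 2 + 3ε/2. Proof in print: R_s is submultiplicative, (n³)^(ω_s/3) ≤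
R_s(⟨n,n,n⟩) (Prop. 5); a triangle-free S ⊆ Δ_N with |S| = N^(2−o(1)) (CKSU05 §6.2, Salem–Spencer)
makes |S| ⊙ ⟨N²,N²,N²⟩ a restriction of T^⊗3 for any T with supp T = supp ⟨N,N,N⟩, and the
asymptotic sum inequality (PROVED in tree: asymptoticSumInequality_rank) gives 2 + 2ω ≤ 3ω_s.
[difficulty: L] (why it might fail: Mathematically safe (CU13 Prop. 5 and Thm. 6 are published
theorems); the risk is formalisation size: triangle-free sets in Δ_N of size N^(2−δ) from
Behrend/Salem–Spencer (Mathlib) and the cube substitution T' ≤ T^⊗3 over the tree's tensorRank/omega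
API.) [CohnUmans2013, arXiv:1207.6528, CohnKleinbergSzegedyUmans2005, Blaser2013]
#3 MetricNoGain (crux) — Quantitative metric no-go (card thick-top-schemes-no-go, sharpened): there
is an absolute c > 0 such that whenever the distance scheme of a connected distance-regular graph
realises ⟨n,n,n⟩, the graph has at least c·n³ distinct distances (rank D+1 ≥ c·n³) — metric
(P-polynomial) schemes buy nothing over abelian groups (CohnUmans2003 Lemma 3.1: |G| ≥ n³), hence
give no bound ω_s < 3. Proved region: thick tops (Hamming q ≥ 3: no ⟨2,2,2⟩ at all; parity tops with
M ≤ 2D/3: n ≤ 2). Calibration: the least D with H(D,2) ⊇ ⟨2,2,2⟩ is 8, the least N with C_N ⊇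
⟨2,2,2⟩ is 16 (rank 9 = n³+1 both; planner's exhaustive search, NOTES). [difficulty: L] (why it
might fail: Checked only at n ≤ 2; antipodal/bipartite tops are bands or anti-diagonals that carry
permutation patterns, fusion forgets the group, and s-rank lower bounds stop at n², so a
parity/antipodal design in H(D,2) or a forms graph with D = o(n³) is excluded by no known argument.)
[arXiv:1207.6528, CohnUmans2003, BrouwerHaemers2012, doi:10.1007/978-3-642-74341-2, arXiv:1410.6294,
Delsarte1973]
#4 CyclicRealization (crux) — Positive milestone in the residual class the card names (translation
schemes of unbounded exponent): for some δ > 0 and infinitely many n, a Schur ring over a CYCLIC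
group Z_N (a translation scheme: class of (x,y) = f(y−x), f(a) = f(0) iff a = 0, closed under
negation, coherent) realises ⟨n,n,n⟩ with at most n^(3−δ) classes — the first beat of the abelian
pigeonhole N ≥ n³ by fusion, and the s-rank cousin of GroupTheoreticSTPP's cyclic packing crux; card
fuzzy-tpp-cyclotomic-schur-rings' D1 (orbit S-rings at n^(2+ε)) implies it. [difficulty: XL] (why it
might fail: The unfused cyclic scheme needs N ≥ n³ and ±-fusion (polygons) gains nothing at n = 2
(first at N = 16); larger multiplier groups K make K-fuzzy sumsets expand (sum-product,
BourgainGlibichukKonyagin2006), so every S-ring over Z_N may inherit rank ≥ n^(3−o(1)); no example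
beats n³ today.) [arXiv:1207.6528, Pratt2024, BourgainGlibichukKonyagin2006,
BlasiakCohnGrochowPrattUmans2023, CohnUmans2003]
#9 RealizationSRank (support) — CU13 Prop. 9 + §4.3 (provable now, known): a commutative association
scheme with r classes realising ⟨n,n,n⟩ yields a tensor with exactly the support of the tree's
matMulTensor ℂ n n n and tensorRank ≤ r — the adjacency algebra is commutative and closed under
conjugate transpose, hence ≅ ℂ^(r'), r' ≤ r, its structural tensor Σ p^(τk)_ij x_i y_j z_k has rank
r', and the realisation maps restrict it (TensorRestrictsTo.tensorRank_le) to weights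
p^(τγ(c,a'))_(α(a,b'),β(b,c')) that are nonzero iff matched. [difficulty: provable-now]
[CohnUmans2013, arXiv:1207.6528]
#9 ThickTopLemma (support) — The card's thick-top lemma, abstract form (provable now, 30 lines):
classes Fin r with a triangle relation Tri, heights h, types par : Fin r → Fin q and a compatibility
predicate Comp; if (i) Tri i j k → h i ≤ h j + h k, (ii) Tri i j k → Comp i (par j) (par k), (iii)
thickness: h j, h k ≤ h i ≤ h j + h k and Comp i (par j) (par k) force Tri i j k, and α, β, γ
realise ⟨n,n,n⟩ over Tri with some α(i₀,j₀) dominating the heights of β(j₀,·), γ(·,i₀), then n ≤ q.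
Proof: with M = α(i₀,j₀), b_k = β(j₀,k), c_k = γ(k,i₀) the realisation gives Tri M b_k' c_k ⟺ k =
k'; if par b_k = par b_k' for k ≠ k' then (iii) forces h b_k' + h c_k < h M and h b_k + h c_k' < h M
while (i) gives the two diagonal sums ≥ h M — summing is absurd; so k ↦ par b_k is injective.
[difficulty: provable-now] [arXiv:1207.6528, doi:10.1007/978-3-642-74341-2]
#9 HammingNoGo (support) — The card's headline corollary (provable now): for q ≥ 3 and every D the
Hamming scheme H(D,q) realises no ⟨2,2,2⟩ — three words over Fin q with pairwise distances (i,j,k)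
exist iff the triangle inequalities hold and i,j,k ≤ D (q ≥ 3; verified against words for D ≤ 4), so
the top used class is thick with one type and ThickTopLemma (after rotating α,β,γ so that the
maximum sits on α) gives n ≤ 1. Exhaustively confirmed for D ≤ 7 (NOTES). Contrast: H(8,2) realises
⟨2,2,2⟩. [difficulty: provable-now] [arXiv:1207.6528, Delsarte1973, doi:10.1007/978-3-642-74341-2]
#9 STPPTransfer (support) — CU13 Thm. 17/19 + Cor. 18 + §6.2 (known, L-sized formalisation): the
abelian STPP packing thesis of route GroupTheoreticSTPP (CThesis, stmt-MatrixMultiplication-0593,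
inlined verbatim) implies CommutativeRealization — symmetric powers Sym^k(𝒞_H^t) of the group scheme
of H realise a single ⟨L,M,N⟩ with (LMN)^((2+ε)/3) beating the rank, and the direct product of the
three rotations makes it square; the resulting schemes are commutative (indeed translation schemes
on H^(tk)). Records that this target is weaker than every group-theoretic thesis on file.
[difficulty: L] [arXiv:1207.6528, CohnKleinbergSzegedyUmans2005]

TWO-LAYER PLAN. WeightRemoval ⇐ TriangleFreeSets (∀ δ > 0, large N: a triangle-free S ⊆ Δ_N with |S|
≥ N^(2−δ), from Mathlib's Behrend
bound) → CubeSubstitution (supp T = supp ⟨N,N,N⟩ ⟹ |S| ⊙ ⟨N²,N²,N²⟩ ≤ T^⊗3) → WeightRemoval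
(asymptotic sum inequality,
proved). MetricNoGain ⇐ ThickTopCase (tops with p^M_bc > 0 on the whole parity-triangle region: n ≤
2, via ThickTopLemma
and the positivity region of classical families, BCN Ch. 9) → ThinTopCase (antipodal/bipartite tops:
fold to the quotient
scheme and count anti-diagonal permutation patterns against injectivity) → MetricNoGain.
CommutativeRealization ⇐
TranslationRealization (Conj. 21 for S-rings over finite abelian groups, the honest residual class)
once CyclicRealization
or card fuzzy-tpp-cyclotomic-schur-rings' D1 shows a first fused design beating n³.

KILL CRITERIA. ¬CommutativeRealization proved (some ε₀ > 0 below which no commutative scheme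
realises ⟨n,n,n⟩ at rank n^(2+ε₀)) closes
the route refuted:CommutativeRealization — and, via STPPTransfer, refutes GroupTheoreticSTPP's
CThesis and CKSU05 Conj.
3.4/4.7 with it (record in the negatives index). MetricNoGain refuted by a distance-regular family
with D = n^(3−Ω(1))
forces a pivot: metric hosts re-enter and the refuting family is itself an ω_s-certificate (if D =
n^(2+o(1)) it proves
the target). CyclicRealization refuted (cyclic S-rings have rank ≥ n^(3−o(1))) together with a proof
of card
fuzzy-tpp-cyclotomic-schur-rings' sum-product obstruction D2 leaves only sporadic/non-Schurian
hosts: route goes dormant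
with a census. GroupTheoreticSTPP's CThesis proved makes the target a corollary (close superseded).
WeightRemoval and the
supports are theorems in print and cannot close the route.

NOT DECOMPOSED YET. The card's K1 (residual census: every low-rank realising scheme is
Schurian-up-to-fusion or a translation scheme) and K2
(thin-top rigidity: n triangles per top class force valencies r^(o(1)) and a Kneser-type packing
bound) are not typeable
as one-line Props without a classification vocabulary and stay prose until MetricNoGain's thin-top
case shows which
invariant (width of the top band, number of vanishing p^k_ij) carries the argument. The cometric
(Q-polynomial) dual
no-go, the Johnson/Grassmann/forms tables, and the exact constant in MetricNoGain (data: rank ≥ n³+1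
at n = 2) are
layer-2 children. Definitions (commutative association scheme, CU13 realisation) are inlined; a
shared Literature notion is
requested below so that cards fuzzy-tpp-cyclotomic-schur-rings and special-weights-s-rank dedupe
against these items.

CHEAPEST FALSIFIER. (1) SAT/SMT search for ⟨3,3,3⟩ inside H(D,2), D = 8…30, and inside the polygon
schemes C_N, N ≤ 120 (729 iff-clauses over
27 integer unknowns; Tri(i,j,k) = parity ∧ triangle inequalities ∧ i+j+k ≤ 2D for cubes, ±i±j±k ≡ 0
for cycles — both
verified against the graphs for small D): a cube design with D+1 well below 27 is strong evidence
against MetricNoGain's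
constant-free truth and D(n) = O(n²) would prove the target outright; the planner ran n = 2
exhaustively (python, seconds):
no ⟨2,2,2⟩ in H(D,q≥3) for D ≤ 7 (lemma: all D), none in H(D,2) for D ≤ 7, first at D = 8; none in
C_N for N ≤ 15, first
at N = 16. (2) Exhaustive search of orbit Schur rings Cyc(N,K), N ≤ 300, all K ≤ (Z/N)^×, for
realisations of ⟨2,2,2⟩ /
⟨3,3,3⟩ with fewer than n³ classes (CyclicRealization's first instance or its absence at small N).

NUMBERS. ω_s ≤ ω < 2.3714 (so a realisation is news only below rank n^2.37); CU13 Thm. 20: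
commutative Schurian schemes give
ω_s ≤ 2.48, 2.41, 2.376 (ω ≤ 2.72, 2.62, 2.564 after the 50% penalty ω ≤ (3ω_s−2)/2); R_s(⟨n,n,n⟩) ≥
n² is the only
general s-rank lower bound (CU13 §3); border s-rank of ⟨2,2,2⟩ = 7 (arXiv:1705.09652). Planner's
data (n = 2): least D
with ⟨2,2,2⟩ ⊆ H(D,2) is 8 (design α = {00↦0, 01↦1, 10↦3, 11↦2}, β = {0, 8, 1, 7}, γ = {0, 3, 8,
5}), least N with
⟨2,2,2⟩ ⊆ C_N is 16 (same design), C_17, C_19 fail, C_18 and C_N for N ≥ 20 succeed (design α =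
2a+b', β = {2,7,3,6},
γ = {2,0,7,9}); abelian groups need |G| ≥ n³ = 8 (CohnUmans2003 Lemma 3.1, proved in tree:
RealizesTPP.mul_mul_le_card).

DEFINITION REQUESTS. Literature notion wanted (shared with cards fuzzy-tpp-cyclotomic-schur-rings,
special-weights-s-rank): `CommAssociationScheme`
(class map with one diagonal class, transpose-closed, coherent, commutative) and
`AssociationScheme.Realizes l m n` (CU13
Def. 11/12), topic Literature/Combinatorics/AssociationSchemes; plus `sRank` (CU13 Def. 1) next to
tensorRank. Cite facts
wanted: CU13 Prop. 5, Thm. 6 (= WeightRemoval), Prop. 9 (= RealizationSRank) — filed here as items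
instead, per plancard
policy (unproved named facts become the first crux).

Novelty: Searches (2026-08-15): lit read arxiv:1207.6528 in full (grep realize|coherent|Conjecture|s-rank:
178 hits; §3 Def.1/Prop.5/Thm.6, §4 Def.8–12/Prop.9/Prop.14, §5 Thm.17–20/Conj.21, §6 Prop.22/Thm.24
read); lit galaxy search --star all "coherent configuration matrix multiplication" (0), "association
scheme realizes matrix multiplication" (0), "commutative coherent configurations" (3: Bailey's book,
arXiv:2105.10679 Chen–Ponomarenko tensor products of CCs, Ito 2019 fusions in fiber-commutative CCs
— none on matrix multiplication), "s-rank exponent of matrix multiplication" (0), "border support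
rank" (1, ECCC 2025/060), "distance-regular graph" --star pdf (10, none touching realisation); lit
search / lit related were unavailable (searchd rc 75, graph reset) — the card's and its refuter's
searches (lit citing arxiv:1207.6528: 50–67 citing works, none developing or obstructing scheme
realisations; zbMATH "coherent configurations matrix multiplication association schemes": no
development; grep of CU13 for distance-regular|P-polynomial|Hamming|Johnson: 0) stand in; grep of
all 36 Theses files of the sub for coherent config|association scheme|Conj 21|s-rank: only
GelfandPairHosts (contrast) and HesseHammingShells (Hamming shells as tensors, unrelated); negatives
index: 0.
Nearest prior art found: CohnUmans2013 = arXiv:1207.6528 (Conj. 21, Prop. 5/9, Thm. 6/17/19/20/24 —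
only Schurian/group examples, no metric-scheme discussion);
BlasiakChurchCohnGrochowNaslundSawinUmans2017 p. 4 (sch  [refs: 1207.6528, 2105.10679, arxiv:1207.6528, CohnUmans2013, BlasiakChurchCohnGrochowNaslundSawinUmans2017]

Barriers (technique_class: coherent-configurations, s-rank, association-schemes): - technique_class: coherent-configurations, s-rank, association-schemes
- Literature.Barriers.MatrixMultiplication.TricoloredSumFreeBarrier: kills STPP/USP designs in
abelian groups of BOUNDED exponent (BCCGNSU17 Thm A/B); the target allows any commutative scheme
(explicitly outside the barrier, BCCGNSU17 p. 4), CyclicRealization lives in Z_N (full slice rank,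
Behrend sets) and MetricNoGain is a no-go, so nothing positive here routes through bounded exponent
— except STPPTransfer's input, which is GroupTheoreticSTPP's business.
- Literature.Barriers.MatrixMultiplication.IrreversibilityBarrier: monomial degenerations of an
irreversible host tensor cannot reach ω = 2 (CVZ Thm 13/14); the host here is the structural tensor
of ℂ^r, the unit tensor ⟨r⟩ — perfectly reversible — and the whole loss sits in the WEIGHTS, paid by
WeightRemoval's 50%; evaded by construction, at the price of s-rank.
- Literature.Barriers.MatrixMultiplication.YoungSubgroupBarrier: non-abelian group hosts (S_n, Young
subgroups) read through character degrees; a commutative scheme has all degrees 1 — not in class.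
- Literature.Barriers.MatrixMultiplication.QuasirandomBarrier: quasirandom/Lie-type groups; not in
class (no group host; Schurian examples enter only through abelian H in STPPTransfer).
- Literature.Barriers.MatrixMultiplication.NormalizerBarrier: subgroups with large normalisers in a
host group; not in class.
- Literature.Barriers.MatrixMultiplication.NilpotentGroupBarrier: p-groups of bounded exp

History (route lifecycle, newest last):
- 2026-08-16T02:18:48Z · AUTO-CRUX: 1 conjecture-grade item(s) promoted to crux (CommutativeRealization) — refuter vetting / tiering apply (operator:999:1362873)
- 2026-08-16T04:10:35Z · AUTO-CRUX (backfill): CommutativeRealization — hypotheses of the deciding theorem that nothing in the route derives are cruxes (operator:999:1085951)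
- 2026-08-24T14:49:07Z · DORMANT — reconciler: no traction for 6.8 d (last activity item-evidence-added at 2026-08-17T18:12:28Z); parked, not closed — `ledger route dormant route-MatrixMultiplica (operator:999:2212170)

sub-problem: MatrixMultiplication · status: dormant · opened planner-plancard-MatrixMultiplication-MatrixM-b51dabbb-0 2026-08-15T13:57:46Z · rev 1 · ledger route-MatrixMultiplication-CommutativeSchemes
GENERATED by the gate from the ledger (D-0016/17). Provers cite these decls: `theorem foo : Summit.MatrixMultiplication.MatrixMultiplication.Theses.CommutativeSchemes.<Decl> := …` in Summits/MatrixMultiplication/MatrixMultiplication/Theorems/<Name>.lean.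
-/

namespace Summit.MatrixMultiplication.MatrixMultiplication.Theses.CommutativeSchemes

open scoped BigOperators Topology Manifold Classical MeasureTheory ProbabilityTheory Matrix InnerProductSpace ComplexConjugate ContinuousMap
open Filter Set Function TopologicalSpace MeasureTheory

attribute [summit_statement] _root_.MatrixMultiplication

/-- item stmt-MatrixMultiplication-9462 · crux (kind.auto-crux: conjecture-grade) · rank 0 · open · by planner
why it might fail: Every known commutative realisation is a Sym-power of bounded-exponent abelian STPP (CU13 Thm 20, ω_s ≤ 2.376) whose ε→0 limit is slice-rank-barred (BCCGNSU17 Thm B); metric hosts are dead (MetricNoGain) and nothing is known to produce thin non-group tops at rank n^(2+ε).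
sources: CohnUmans2013, arXiv:1207.6528, CohnKleinbergSzegedyUmans2005, BlasiakChurchCohnGrochowNaslundSawinUmans2017
[target] CU13 Conjecture 21, ε-form: for every ε > 0 some commutative association scheme with at
most n^(2+ε) classes realises ⟨n,n,n⟩, n ≥ 2 (card thick-top-schemes-no-go, Assembly sketch;
CohnUmans2013 Conj. 21). -/
@[route_item "route-MatrixMultiplication-CommutativeSchemes", crux]
def CommutativeRealization : Prop :=
  ∀ ε : ℝ, 0 < ε → ∃ n : ℕ, 2 ≤ n ∧ ∃ (X : Type) (_ : Fintype X) (r : ℕ) (cls : X → X → Fin r), (r : ℝ) ≤ (n : ℝ) ^ (2 + ε) ∧ (∀ x y z : X, cls x y = cls z z ↔ x = y) ∧ (∃ τ : Fin r → Fin r, ∀ x y : X, cls y x = τ (cls x y)) ∧ (∃ p : Fin r → Fin r → Fin r → ℕ, (∀ (a b : Fin r) (x y : X), (Finset.univ.filter (fun z : X => cls x z = a ∧ cls z y = b)).card = p a b (cls x y)) ∧ ∀ a b c : Fin r, p a b c = p b a c) ∧ ∃ α β γ : Fin n × Fin n → Fin r, Function.Injective α ∧ Function.Injective β ∧ Function.Injective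 γ ∧ ∀ a a' b b' c c' : Fin n, ((∃ x y z : X, cls x y = α (a, b') ∧ cls y z = β (b, c') ∧ cls z x = γ (c, a')) ↔ (a = a' ∧ b = b' ∧ c = c'))

/-- item stmt-MatrixMultiplication-9463 · crux · rank 2 · closed · proved by Summit.MatrixMultiplication.MatrixMultiplication.Theorems.weightRemoval_proof @ f81eb451430e (prover) · by planner
why it might fail: Mathematically safe (CU13 Prop. 5 and Thm. 6 are published theorems); the risk is formalisation size: triangle-free sets in Δ_N of size N^(2−δ) from Behrend/Salem–Spencer (Mathlib) and the cube substitution T' ≤ T^⊗3 over the tree's tensorRank/omega API.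
sources: CohnUmans2013, arXiv:1207.6528, CohnKleinbergSzegedyUmans2005, Blaser2013
[crux] CU13 Prop. 5 + Thm. 6 in finite form (the unvendored named fact the assembly needs, ranked
first by plancard policy): if some tensor with the support of ⟨n,n,n⟩ (n ≥ 2) has rank ≤ n^(2+ε),
then ω(ℂ) ≤ 2 + 3ε/2. Proof in print: R_s is submultiplicative, (n³)^(ω_s/3) ≤ R_s(⟨n,n,n⟩) (Prop.
5); a triangle-free S ⊆ Δ_N with |S| = N^(2−o(1)) (CKSU05 §6.2, Salem–Spencer) makes |S| ⊙
⟨N²,N²,N²⟩ a restriction of T^⊗3 for any T with supp T = supp ⟨N,N,N⟩, and the asymptotic sum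
inequality (PROVED in tree: asymptoticSumInequality_rank) gives 2 + 2ω ≤ 3ω_s. [difficulty: L] -/
@[route_item "route-MatrixMultiplication-CommutativeSchemes", crux]
def WeightRemoval : Prop :=
  ∀ ε : ℝ, 0 < ε → ∀ n : ℕ, 2 ≤ n → (∃ t : (Fin n × Fin n) → (Fin n × Fin n) → (Fin n × Fin n) → ℂ, (∀ i j k, t i j k ≠ 0 ↔ Literature.Computability.AlgebraicComplexity.matMulTensor ℂ n n n i j k ≠ 0) ∧ (Literature.Computability.AlgebraicComplexity.tensorRank t : ℝ) ≤ (n : ℝ) ^ (2 + ε)) → Literature.Computability.AlgebraicComplexity.omega ℂ ≤ 2 + 3 / 2 * ε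

/-- item stmt-MatrixMultiplication-9464 · crux · rank 3 · open · by planner
why it might fail: Checked only at n ≤ 2; antipodal/bipartite tops are bands or anti-diagonals that carry permutation patterns, fusion forgets the group, and s-rank lower bounds stop at n², so a parity/antipodal design in H(D,2) or a forms graph with D = o(n³) is excluded by no known argument.
sources: arXiv:1207.6528, CohnUmans2003, BrouwerHaemers2012, doi:10.1007/978-3-642-74341-2, arXiv:1410.6294, Delsarte1973
[crux] Quantitative metric no-go (card thick-top-schemes-no-go, sharpened): there is an absolute c >
0 such that whenever the distance scheme of a connected distance-regular graph realises ⟨n,n,n⟩, the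
graph has at least c·n³ distinct distances (rank D+1 ≥ c·n³) — metric (P-polynomial) schemes buy
nothing over abelian groups (CohnUmans2003 Lemma 3.1: |G| ≥ n³), hence give no bound ω_s < 3. Proved
region: thick tops (Hamming q ≥ 3: no ⟨2,2,2⟩ at all; parity tops with M ≤ 2D/3: n ≤ 2).
Calibration: the least D with H(D,2) ⊇ ⟨2,2,2⟩ is 8, the least N with C_N ⊇ ⟨2,2,2⟩ is 16 (rank 9 =
n³+1 both; planner's exhaustive search, NOTES). [difficulty: L] -/
@[route_item "route-MatrixMultiplication-CommutativeSchemes"]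
def MetricNoGain : Prop :=
  ∃ c : ℝ, 0 < c ∧ ∀ (X : Type) [Fintype X] (G : SimpleGraph X) [DecidableRel G.Adj], G.Connected → (∃ p : ℕ → ℕ → ℕ → ℕ, ∀ (i j : ℕ) (x y : X), (Finset.univ.filter (fun z : X => G.dist x z = i ∧ G.dist z y = j)).card = p i j (G.dist x y)) → ∀ (n : ℕ) (α β γ : Fin n × Fin n → ℕ), (Function.Injective α ∧ Function.Injective β ∧ Function.Injective γ ∧ ∀ a a' b b' c c' : Fin n, ((∃ x y z : X, G.dist x y = α (a, b') ∧ G.dist y z = β (b, c') ∧ G.dist z x = γ (c, a')) ↔ (a = a' ∧ b = b' ∧ c = c'))) → c * (n : ℝ) ^ 3 ≤ ((Finset.univ.image (fun e : X × X => G.dist e.1 e.2)).card : ℝ)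

/-- item stmt-MatrixMultiplication-9465 · crux · rank 4 · open · by planner
why it might fail: The unfused cyclic scheme needs N ≥ n³ and ±-fusion (polygons) gains nothing at n = 2 (first at N = 16); larger multiplier groups K make K-fuzzy sumsets expand (sum-product, BourgainGlibichukKonyagin2006), so every S-ring over Z_N may inherit rank ≥ n^(3−o(1)); no example beats n³ today.
sources: arXiv:1207.6528, Pratt2024, BourgainGlibichukKonyagin2006, BlasiakCohnGrochowPrattUmans2023, CohnUmans2003
[crux] Positive milestone in the residual class the card names (translation schemes of unbounded
exponent): for some δ > 0 and infinitely many n, a Schur ring over a CYCLIC group Z_N (a translation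
scheme: class of (x,y) = f(y−x), f(a) = f(0) iff a = 0, closed under negation, coherent) realises
⟨n,n,n⟩ with at most n^(3−δ) classes — the first beat of the abelian pigeonhole N ≥ n³ by fusion,
and the s-rank cousin of GroupTheoreticSTPP's cyclic packing crux; card
fuzzy-tpp-cyclotomic-schur-rings' D1 (orbit S-rings at n^(2+ε)) implies it. [difficulty: XL] -/
@[route_item "route-MatrixMultiplication-CommutativeSchemes"]
def CyclicRealization : Prop :=
  ∃ δ : ℝ, 0 < δ ∧ ∀ n₀ : ℕ, ∃ n : ℕ, n₀ ≤ n ∧ ∃ (N : ℕ) (_ : NeZero N) (r : ℕ) (f : ZMod N → Fin r), (r : ℝ) ≤ (n : ℝ) ^ (3 - δ) ∧ (∀ a : ZMod N, f a = f 0 ↔ a = 0) ∧ (∃ τ : Fin r → Fin r, ∀ a : ZMod N, f (-a) = τ (f a)) ∧ (∃ p : Fin r → Fin r → Fin r → ℕ, ∀ (i j : Fin r) (d : ZMod N), (Finset.univ.filter (fun w : ZMod N => f w = i ∧ f (d - w) = j)).card = p i j (f d)) ∧ ∃ α β γ : Fin n × Fin n → Fin r, Function.Injective α ∧ Function.Injective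 β ∧ Function.Injective γ ∧ ∀ a a' b b' c c' : Fin n, ((∃ x y z : ZMod N, f (y - x) = α (a, b') ∧ f (z - y) = β (b, c') ∧ f (x - z) = γ (c, a')) ↔ (a = a' ∧ b = b' ∧ c = c'))

/-- item stmt-MatrixMultiplication-9466 · support · rank 9 · closed · proved by Summit.MatrixMultiplication.MatrixMultiplication.Theorems.realizationSRank_proof @ 46997ff96d8d (prover) · by planner
sources: CohnUmans2013, arXiv:1207.6528
[support] CU13 Prop. 9 + §4.3 (provable now, known): a commutative association scheme with r classes
realising ⟨n,n,n⟩ yields a tensor with exactly the support of the tree's matMulTensor ℂ n n n and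
tensorRank ≤ r — the adjacency algebra is commutative and closed under conjugate transpose, hence ≅
ℂ^(r'), r' ≤ r, its structural tensor Σ p^(τk)_ij x_i y_j z_k has rank r', and the realisation maps
restrict it (TensorRestrictsTo.tensorRank_le) to weights p^(τγ(c,a'))_(α(a,b'),β(b,c')) that are
nonzero iff matched. [difficulty: provable-now] -/
@[route_item "route-MatrixMultiplication-CommutativeSchemes", crux]
def RealizationSRank : Prop :=
  ∀ (n : ℕ) (X : Type) [Fintype X] (r : ℕ) (cls : X → X → Fin r), (∀ x y z : X, cls x y = cls z z ↔ x = y) → (∃ τ : Fin r → Fin r, ∀ x y : X, cls y x = τ (cls x y)) → (∃ p : Fin r → Fin r → Fin r → ℕ, (∀ (a b : Fin r) (x y : X), (Finset.univ.filter (fun z : X => cls x z = a ∧ cls z y = b)).card = p a b (cls x y)) ∧ ∀ a b c : Fin r, p a b c = p b a c) → ∀ α β γ : Fin n × Fin n → Fin r, (Function.Injective α ∧ Function.Injective β ∧ Function.Injective γ ∧ ∀ a a' b b' c c' : Fin n, ((∃ x y z : X, cls x y = α (a, b') ∧ cls y z = β (b, c') ∧ cls z x = γ (c, a')) ↔ (a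 = a' ∧ b = b' ∧ c = c'))) → ∃ t : (Fin n × Fin n) → (Fin n × Fin n) → (Fin n × Fin n) → ℂ, (∀ i j k, t i j k ≠ 0 ↔ Literature.Computability.AlgebraicComplexity.matMulTensor ℂ n n n i j k ≠ 0) ∧ Literature.Computability.AlgebraicComplexity.tensorRank t ≤ r

/-- item stmt-MatrixMultiplication-9467 · support · rank 9 · closed · proved by Summit.MatrixMultiplication.MatrixMultiplication.Theorems.thickTopLemma_proof @ d87eea47b023 (prover) · by planner
sources: arXiv:1207.6528, doi:10.1007/978-3-642-74341-2
[support] The card's thick-top lemma, abstract form (provable now, 30 lines): classes Fin r with a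
triangle relation Tri, heights h, types par : Fin r → Fin q and a compatibility predicate Comp; if
(i) Tri i j k → h i ≤ h j + h k, (ii) Tri i j k → Comp i (par j) (par k), (iii) thickness: h j, h k
≤ h i ≤ h j + h k and Comp i (par j) (par k) force Tri i j k, and α, β, γ realise ⟨n,n,n⟩ over Tri
with some α(i₀,j₀) dominating the heights of β(j₀,·), γ(·,i₀), then n ≤ q. Proof: with M = α(i₀,j₀),
b_k = β(j₀,k), c_k = γ(k,i₀) the realisation gives Tri M b_k' c_k ⟺ k = k'; if par b_k = par b_k'
for k ≠ k' then (iii) forces h b_k' + h c_k < h M and h b_k + h c_k' < h M while (i) gives the two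
diagonal sums ≥ h M — summing is absurd; so k ↦ par b_k is injective. [difficulty: provable-now] -/
@[route_item "route-MatrixMultiplication-CommutativeSchemes"]
def ThickTopLemma : Prop :=
  ∀ (r n q : ℕ) (Tri : Fin r → Fin r → Fin r → Prop) (h : Fin r → ℕ) (par : Fin r → Fin q) (Comp : Fin r → Fin q → Fin q → Prop) (α β γ : Fin n × Fin n → Fin r), (∀ i j k, Tri i j k → h i ≤ h j + h k) → (∀ i j k, Tri i j k → Comp i (par j) (par k)) → (∀ i j k, h j ≤ h i → h k ≤ h i → h i ≤ h j + h k → Comp i (par j) (par k) → Tri i j k) → (∀ a a' b b' c c' : Fin n, (Tri (α (a, b')) (β (b, c')) (γ (c, a')) ↔ (a = a' ∧ b = b' ∧ c = c'))) → (∃ i₀ j₀ : Fin n, ∀ k : Fin n, h (β (j₀, k)) ≤ h (α (i₀, j₀)) ∧ h (γ (k, i₀)) ≤ h (α (i₀, j₀))) → n ≤ q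

/-- item stmt-MatrixMultiplication-9468 · support · rank 9 · closed · proved by Summit.MatrixMultiplication.MatrixMultiplication.Theorems.hammingNoGo_proof @ c72aee93d46f (prover) · by planner
sources: arXiv:1207.6528, Delsarte1973, doi:10.1007/978-3-642-74341-2
[support] The card's headline corollary (provable now): for q ≥ 3 and every D the Hamming scheme
H(D,q) realises no ⟨2,2,2⟩ — three words over Fin q with pairwise distances (i,j,k) exist iff the
triangle inequalities hold and i,j,k ≤ D (q ≥ 3; verified against words for D ≤ 4), so the top used
class is thick with one type and ThickTopLemma (after rotating α,β,γ so that the maximum sits on α)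
gives n ≤ 1. Exhaustively confirmed for D ≤ 7 (NOTES). Contrast: H(8,2) realises ⟨2,2,2⟩.
[difficulty: provable-now] -/
@[route_item "route-MatrixMultiplication-CommutativeSchemes"]
def HammingNoGo : Prop :=
  ∀ D q : ℕ, 3 ≤ q → ¬ ∃ α β γ : Fin 2 × Fin 2 → ℕ, Function.Injective α ∧ Function.Injective β ∧ Function.Injective γ ∧ ∀ a a' b b' c c' : Fin 2, ((∃ x y z : Fin D → Fin q, hammingDist x y = α (a, b') ∧ hammingDist y z = β (b, c') ∧ hammingDist z x = γ (c, a')) ↔ (a = a' ∧ b = b' ∧ c = c'))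

/-- item stmt-MatrixMultiplication-9469 · support · rank 9 · closed · proved by Summit.MatrixMultiplication.MatrixMultiplication.Theorems.stppTransfer_proof @ 9a23462d1ba5 (prover) · by planner
sources: arXiv:1207.6528, CohnKleinbergSzegedyUmans2005
[support] CU13 Thm. 17/19 + Cor. 18 + §6.2 (known, L-sized formalisation): the abelian STPP packing
thesis of route GroupTheoreticSTPP (CThesis, stmt-MatrixMultiplication-0593, inlined verbatim)
implies CommutativeRealization — symmetric powers Sym^k(𝒞_H^t) of the group scheme of H realise a
single ⟨L,M,N⟩ with (LMN)^((2+ε)/3) beating the rank, and the direct product of the three rotations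
makes it square; the resulting schemes are commutative (indeed translation schemes on H^(tk)).
Records that this target is weaker than every group-theoretic thesis on file. [difficulty: L] -/
@[route_item "route-MatrixMultiplication-CommutativeSchemes"]
def STPPTransfer : Prop :=
  (∀ ε : ℝ, 0 < ε → ∃ (H : Type) (_ : AddCommGroup H) (_ : Fintype H) (N : ℕ) (A B C : Fin N → Finset H), (∀ i j k : Fin N, ∀ s ∈ A k, ∀ s' ∈ A i, ∀ t ∈ B i, ∀ t' ∈ B j, ∀ u ∈ C j, ∀ u' ∈ C k, (s' - s) + (t' - t) + (u' - u) = 0 → i = j ∧ j = k ∧ s = s' ∧ t = t' ∧ u = u') ∧ (Fintype.card H : ℝ) < ∑ i, (((A i).card * (B i).card * (C i).card : ℕ) : ℝ) ^ ((2 + ε) / 3)) → CommutativeRealization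

/-- item stmt-MatrixMultiplication-9470 · assembly · rank 1 · closed · proved by Summit.MatrixMultiplication.MatrixMultiplication.Theorems.commutativeSchemes_assembly_proof @ 19c6641fda3f (prover) · by planner
sources: arXiv:1207.6528, Blaser2013
[assembly] CommutativeRealization → RealizationSRank → WeightRemoval → ω(ℂ) = 2. -/
@[route_item "route-MatrixMultiplication-CommutativeSchemes"]
def Assembly : Prop :=
  CommutativeRealization → RealizationSRank → WeightRemoval → MatrixMultiplication

/-! D-0027 §2.1 — DECIDING THEOREM (planner-authored via `route open/edit --closes-file`; by planner-rrepair-MatrixMultiplication-Commutati-866af5b2-g2-0 2026-08-15T16:33:05Z):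
its hypotheses are this route's items and its conclusion the sub-problem Statement (glue_lint), and it elaborates with this file. -/

/-- DECIDING THEOREM (D-0027 §2.1): the target (CU13 Conj. 21, ε-form), the s-rank transfer
(CU13 Prop. 9) and weight removal (CU13 Prop. 5 + Thm. 6) decide `ω(ℂ) = 2`; bookkeeping over the
cone (`omega_two_le`): for `δ > 0` take `ε = 2δ/3`, get a scheme with `r ≤ n^(2+ε)` classes realising
`⟨n,n,n⟩`, a tensor with the support of `⟨n,n,n⟩` and rank `≤ r`, hence `ω ≤ 2 + (3/2)ε = 2 + δ`. -/
@[closes "route-MatrixMultiplication-CommutativeSchemes"] theorem closes (hC : CommutativeRealization) (hS : RealizationSRank) (hW : WeightRemoval) :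
    MatrixMultiplication := by
  show Literature.Computability.AlgebraicComplexity.omega ℂ = 2
  apply le_antisymm _ (Literature.Computability.AlgebraicComplexity.omega_two_le ℂ)
  apply le_of_forall_pos_le_add
  intro δ hδ
  obtain ⟨n, hn, X, hX, r, cls, hr, h1, h2, h3, α, β, γ, hreal⟩ := hC (2 / 3 * δ) (by positivity)
  obtain ⟨t, ht, htr⟩ := @hS n X hX r cls h1 h2 h3 α β γ hreal
  have hw := hW (2 / 3 * δ) (by positivity) n hn ⟨t, ht, le_trans (by exact_mod_cast htr) hr⟩
  calc Literature.Computability.AlgebraicComplexity.omega ℂ ≤ 2 + 3 / 2 * (2 / 3 * δ) := hw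
    _ = 2 + δ := by ring

end Summit.MatrixMultiplication.MatrixMultiplication.Theses.CommutativeSchemes
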